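import Mathlib
import HarnessLib
import HarnessLib.Audit
import Summits.MatrixMultiplication.Statement
import Literature.Computability.AlgebraicComplexity.MatrixMultiplicationExponent
import Literature.Computability.AlgebraicComplexity.AsymptoticSpectrum
import HarnessLib.Audit.Status.Attr

/-!
Route: ProbeRankThreshold

DORMANT since 2026-08-22T08:31:31Z (reconciler: no traction for 5.2 d (last activity statement-grounded at 2026-08-17T02:57:16Z); parked, not closed — `ledger route dormant route-MatrixMultiplication-ProbeRankThreshold --off` to reactiv) — unstaffed, not closed; items shared with open routes are served there. `ledger route dormant <id> --off` reactivates.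

# Route ProbeRankThreshold — entanglement-scale threshold — beat the X-rank law n^(3-θ) at probe
rank n^θ (θ ≤ 1/2) and ω > 2 follows

REFUTATION line (targets ¬MatrixMultiplication), realising card probe-entanglement-threshold in the
one regime where its
mechanism can touch ω. Read every leg of a rank-one term of a bilinear algorithm ⟨n,n,n⟩ = Σ_(l<r)
w_l⊗u_l⊗v_l as an n×n
matrix and call its matrix rank the PROBE RANK (Schmidt rank across the row|column cut;
GL_n³-invariant; the schoolbook
algorithm is the point where all 3r probe ranks are 1). X = ScaleDeficit: there are an entanglement
scale θ ∈ (0, 1/2] and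
δ > 0 such that, for infinitely many n, every decomposition of ⟨n,n,n⟩ all of whose probes have rank
≤ n^θ has at least
n^(3−θ(1−δ)) terms. The provable frame: (i) X-RANK LAW (support XRankLaw, one flattening of the
6-leg tensor): Σ_l rank(u_l)
≥ n³, so such decompositions have ≥ n^(3−θ) terms — X asks to beat this rank-method bound by the
factor n^(θδ); (ii)
THRESHOLD TRANSFER (support RecursionTransfer + cone): if ω(ℂ) = 2, recursion on a base ⟨a,a,a⟩, a =
⌊n^θ⌋, with classical
inner blocks gives probe rank ≤ a and only C_δ·n^(3−θ(1−δ/2)) terms for every large n, contradicting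
X. Hence X → ¬(ω(ℂ) = 2).
Lean: `∃ θ : ℝ, 0 < θ ∧ θ ≤ 1 / 2 ∧ ∃ δ : ℝ, 0 < δ ∧ ∀ n₀ : ℕ, ∃ n : ℕ, n₀ ≤ n ∧ ∀ (r : ℕ) (w u v :
Fin r → Fin n × Fin n → ℂ), Literature.Computability.AlgebraicComplexity.matMulTensor ℂ n n n = ∑ i,
Literature.Computability.AlgebraicComplexity.triad (w i) (u i) (v i) → (∀ i, ((Matrix.of fun p q =>
w i (p, q)).rank : ℝ) ≤ (n : ℝ) ^ θ ∧ ((Matrix.of fun p q => u i (p, q)).rank : ℝ) ≤ (n : ℝ) ^ θ ∧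
((Matrix.of fun p q => v i (p, q)).rank : ℝ) ≤ (n : ℝ) ^ θ) → (n : ℝ) ^ (3 - θ * (1 - δ)) ≤ (r : ℝ)`

## Assembly
Pure bookkeeping over the cone. Assume ScaleDeficit (θ, δ) and MatrixMultiplication (ω(ℂ) = 2). By
exists_tensorRank_matMulTensor_le_rpow (δ/2) there is C with R(⟨a,a,a⟩) ≤ C·a^(2+δ/2) for all a ≥ 1;
take a witnessing
decomposition (exists_triad_decomposition_tensorRank). For each of the infinitely many n of
ScaleDeficit put a := ⌊n^θ⌋₊ ≥ 1,
m := ⌈n/a⌉₊, so n ≤ a·m and m ≤ 3n^(1−θ); RecursionTransfer yields a decomposition of ⟨n,n,n⟩ with ≤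
C·a^(2+δ/2)·m³ ≤ 27C·n^(3−θ+θδ/2)
terms and all probe ranks ≤ a ≤ n^θ; ScaleDeficit gives n^(3−θ+θδ) ≤ 27C·n^(3−θ+θδ/2), i.e. n^(θδ/2)
≤ 27C, false for n large.
Hence ¬(ω(ℂ) = 2) = ¬MatrixMultiplication (MatrixMultiplication_iff). RecursionTransfer is a support
item provable now; the
assembly prover may inline it.

Rationale: WHY THIS LINE. The card's fixed-entanglement programme is settled here and cannot see ω: the new cut
(X-row, Y-row, Y-col) | (X-col, Z-row,
Z-col) of the 6-leg tensor separates all three EPR pairs of ⟨n,n,n⟩ while splitting only the X-leg,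
so Σ_l rank(u_l) ≥ n³
(XRankLaw; the card's F1 Σ ρ_u ρ_v ρ_w ≥ n³ is the weaker all-legs cut), i.e. R_ρ(n) ≥ n³/ρ, and
Kronecker powers of Pan's
1972 two-fold trilinear aggregation (2⊙⟨m⟩ in m³+3m² products, all probes 2-sparse or row+column
sums: Pan1984 §4,
Pan1978, Kronsjo1986 pp. 16–20; support PanAggregation / FixedRankSaturation) give R_ρ(n) ≤ (1+o(1))
n³/ρ for ρ = 2^k —
so R_ρ(n) ~ n³/ρ at every FIXED ρ, the card's crux N1 (n³ρ^(−(1−δ)) for all large ρ) is false, and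
recursion from an
ω = 2 world only predicts n³ρ^(−(1−ε)), weaker than what aggregation achieves: at fixed ρ the
filtration is ω-blind.
What survives is the SCALE regime ρ = n^θ: writing the savings exponent s(θ) (R_(n^θ)(n) =
n^(3−s(θ)+o(1))), the frame
gives θ·max(3−ω, 1−c(θ)) ≤ s(θ) ≤ θ with c(θ) = log₂(1+3·2^(−1/θ)) from Pan-2 powers with blocks ≤
2^(1/θ) (and slope
log 2.388/log 3 ≈ 0.79 up to θ ≈ 0.26 from Pan's ⟨70;143640⟩, whose probes have rank ≤ 3), while ω =
2 forces
s(θ) ≥ θ(1−ε) at EVERY θ; X = "s(θ) ≤ θ(1−δ) for one θ ≤ 1/2" therefore refutes ω = 2, is not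
implied by any value of ω
(for θ ≥ 1−(ω−2) it would be; hence the cap θ ≤ 1/2), and lives in a model with a proved
super-quadratic baseline
n^(3−θ) whose extremisers at fixed ρ are KNOWN (aggregation designs) — the imported idea is
stability of a tight
flattening inequality (rank-additive decompositions of an invertible matrix = systems of
complementary idempotents,
Cochran-type rigidity) plus the strictness phenomenon of CoppersmithWinograd1982 (a basic algorithm
never meets its
flattening count), transplanted from the x-variable count to the X-rank count. Nothing here is in
the negatives index
(empty) or in the 20 open routes (BorderRankLowerBound / FidelityWitnesses attack unrestricted
(border) rank at exponent
2+δ; StabilizerTensorRank restricts the coefficient alphabet, not the Schmidt rank; StrassenDefect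
is an upper-bound
self-reduction line).

RANKED CRUXES. #2 ScaleDeficit (crux) — X itself (card item N1 moved to the scale ρ = n^θ, the only
regime consistent with aggregation): ∃ θ ∈ (0,1/2], δ > 0 such that for infinitely many n every
decomposition of ⟨n,n,n⟩ into r rank-one terms whose 3r probes (legs read as n×n matrices) all have
rank ≤ n^θ has r ≥ n^(3−θ(1−δ)). Baseline r ≥ n^(3−θ) is XRankLaw; the crux is the extra factor
n^(θδ). [difficulty: open-problem] (why it might fail: False if ω=2 (recursion reaches n^(3−θ(1−ε))
at every θ). False even with ω>2 if some bounded design is flat-tight (¬StrictXRankLaw with m ≤ p²ᶿ…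
i.e. log p/log m ≥ θ) or a design family has slope → 1 at bounded block size; only tool today is the
rank-method bound n^(3−θ) it must beat.) [Pan1984, Pan1978, CoppersmithWinograd1982,
EfremenkoGargOliveiraWigderson2018, Blaser2013, SchwartzZwecher2026]
#3 StrictXRankLaw (crux) — NO FLAT-TIGHT DESIGN (first rigidity statement of the model; card item N2
corrected by the audit and by XRankLaw): for all s, m ≥ 1, p ≥ 2 and every decomposition of the
direct sum s⊙⟨m,m,m⟩ (= kroneckerTensor (unitTensor s) ⟨m,m,m⟩) into r terms whose X-, Y- and
Z-probes have rank-sum over the s copies ≤ p, one has r·p > s·m³ strictly (XRankLaw gives ≥;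
equality would force every X-probe rank-sum to equal p with the flattening exactly additive). A
flat-tight design (equality) with log p/log m ≥ θ would, by Kronecker powers and block embedding,
give R_(n^θ')(n) = O(n^(3−θ')) for all θ' ≤ log p/log m and kill ScaleDeficit there; so this crux is
informative both ways and is the refuters' natural target in finite form. [difficulty: L] (why it
might fail: For p=2, s=1 the window is [m³/2, m³/2+3m²] (XRankLaw vs Pan) and nothing known excludes
r = m³/2 exactly for large m; weighted aggregation with internal cancellation, or de
Groote-inequivalent tight schemes beyond ⟨2,2,2⟩ (where all optimal schemes are X-tight but not
flat), could realise equality.) [CoppersmithWinograd1982, DeGroote1978, Pan1984,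
BurgisserClausenShokrollahi1997]
#4 TwoProbeSecondOrder (crux) — SECOND-ORDER OPTIMALITY OF AGGREGATION AT ENTANGLEMENT 2 (the
audit's "right N2"): ∃ c > 0 such that for all large n every decomposition of ⟨n,n,n⟩ whose probes
all have rank ≤ 2 has ≥ n³/2 + c·n² terms. Known: n³/2 ≤ R_2(n) ≤ n³/2 + 3n² + O(n) (XRankLaw; Pan-2
on ⟨2m⟩ = 4 block pairs, padding for odd n). The quantitative shadow of StrictXRankLaw at p = 2 and
the first test of the stability method (near-additive flattenings ⇒ near-idempotent structure ⇒
correction terms cost ≥ c·n²). [difficulty: M] (why it might fail: The 3m² correction products of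
Pan-2 might be compressible to o(m²) by sharing them with the main aggregates or across the four
block pairs (leading-coefficient reductions of this kind exist for arithmetic counts: Winograd,
Karstadt–Schwartz, SchwartzZwecher2026); then R_2(n) = n³/2 + o(n²).) [Pan1984, Pan1980,
SchwartzZwecher2026, Kronsjo1986]
#9 XRankLaw (support) — X-RANK LAW (provable now; supersedes the card's F1): for every decomposition
⟨k,m,n⟩ = Σ_(i<r) w_i⊗u_i⊗v_i over ℂ, Σ_i rank(u_i read as a k×m matrix) ≥ k·m·n. Proof: flatten the
6-leg tensor with rows (b.1, c.1, c.2) and columns (b.2, a.1, a.2) (slots a = Z-position (κ,ν), b =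
X (κ,μ), c = Y (μ,ν) of matMulTensor): ⟨k,m,n⟩ becomes a permutation matrix of rank kmn, the i-th
term becomes U_i ⊗ (v_i w_iᵀ-block) of rank rank(U_i); rank is subadditive (Matrix.rank_add_le). By
the cyclic symmetry the same holds for Σ rank(v_i) and Σ rank(w_i). Corollary: probe rank ≤ ρ on the
X-legs alone forces r ≥ kmn/ρ. Verified numerically (exact arithmetic) for k=m=n ≤ 3 in the planner
folder. [difficulty: provable-now] [Blaser2013, Landsberg2017, ChristandlVranaZuiddam2023]
#9 RecursionTransfer (support) — THRESHOLD ENGINE (card F2, provable now): from any decomposition of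
⟨a,a,a⟩ into r terms and any m, n with n ≤ a·m, build a decomposition of ⟨n,n,n⟩ into r·m³ terms all
of whose probes have rank ≤ a: Kronecker product with the schoolbook decomposition of ⟨m,m,m⟩
(kroneckerTensor_matMulTensor / doubleIndexEquiv; the probe u_i ⊗ e_pq is U_i ⊗ E_pq, supported on a
rows, rank ≤ a), then restrict all six indices along Fin n ↪ Fin (a·m) (matMulTensor entries depend
only on index equalities; probes become submatrices, rank non-increasing, Matrix.rank_submatrix_le).
Used by Assembly with a = ⌊n^θ⌋, m = ⌈n/a⌉ and r = R(⟨a,a,a⟩) ≤ C·a^(2+δ/2) from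
exists_tensorRank_matMulTensor_le_rpow (+ exists_triad_decomposition_tensorRank). [difficulty:
provable-now] [Blaser2013, BurgisserClausenShokrollahi1997]
#9 PanAggregation (support) — PAN'S TWO-FOLD AGGREGATION, TENSORED ONCE (calibration; provable now,
laborious): for every m, ⟨2m,2m,2m⟩ has a decomposition into 4m³ + 12m² terms all of whose probes
have rank ≤ 2. Construction: ⟨2,2,2⟩ ≤ ⟨8⟩ splits ⟨2m⟩ into 8 block products = 4 disjoint pairs;
each pair 2⊙⟨m⟩ = Σ_ijk (a_ij+u_jk)(b_jk+v_ki)(c_ki+w_ij) − Σ_ij a_ij(Σ_k b_jk + Σ_k v_ki)w_ij −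
Σ_ki (Σ_j a_ij + Σ_j u_jk)v_ki c_ki − Σ_jk u_jk b_jk(Σ_i c_ki + Σ_i w_ij) (m³ + 3m² products;
identity checked in exact arithmetic for m = 3); every probe is a 2-entry matrix or
entry+row/column-sum, rank ≤ 2 after block placement (Pan1984 §4 eqs (4.1)–(4.3) = Pan 1972;
Kronsjo1986 pp. 18–20 prints the 3-fold sibling ⟨70;143640⟩ with probes of rank ≤ 3). [difficulty:
M] [Pan1984, Pan1978, Kronsjo1986]
#9 FixedRankSaturation (support) — FIXED-ENTANGLEMENT SATURATION (the formal refutation of the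
card's original N1/N2 and the reason the route lives at scale n^θ): for every k and ε > 0, for all
large n, ⟨n,n,n⟩ has a decomposition with ≤ (1+ε)n³/2^k terms and all probe ranks ≤ 2^k. Proof: k-th
Kronecker power of the pair design (2⊙⟨m⟩ in m³+3m², probe rank-sums ≤ 2 ⇒ 2^k⊙⟨m^k⟩ in (m³+3m²)^k
with rank-sums ≤ 2^k), block embedding ⟨2^j,2^j,2^j⟩ ≤ ⟨8^j⟩ with 8^j = 2^k·2^(3j−k) (j = ⌈k/3⌉)
into ⟨2^j m^k⟩, m → ∞, and zero-padding monotonicity n ≤ 2^j m^k ≤ (1+1/m)^k n. With XRankLaw: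
R_ρ(n) = (1+o(1))·n³/ρ along ρ = 2^k — the fixed-ρ filtration is exactly solved and ω-blind.
[difficulty: L] [Pan1984, Pan1978, Blaser2013]

TWO-LAYER PLAN. Once StrictXRankLaw or TwoProbeSecondOrder closes: ScaleDeficit ⇐
StabilityOfXRankLaw (near-additive flattening decompositions
of ⟨n,n,n⟩ are, up to o(n³) terms, systems of complementary idempotents of aggregation type) →
BlockSizeDeficit (an
aggregation-type system with probe rank ≤ ρ and blocks ≤ b loses a factor ≥ (1+γ/b) per doubling of
ρ) → ScaleDeficit
(k ≤ 3, depth 1). If StrictXRankLaw closes REFUTED with log p/log m ≥ 1/2 the route closes; with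
smaller ratio, restate
ScaleDeficit on θ ∈ (log p/log m, 1/2].

KILL CRITERIA. Close `refuted:ScaleDeficit` if (a) any positive route proves ω(ℂ) = 2 (Assembly's
contrapositive), or (b) a flat-tight design
(¬StrictXRankLaw) with log p/log m ≥ 1/2, or a bounded-block design family whose slope
log(s·m³/r)/log p tends to 1, is
exhibited — its Kronecker powers refute ScaleDeficit for every θ ≤ 1/2. A flat-tight design with
smaller ratio θ₀ forces
the restate θ ∈ (θ₀, 1/2]. TwoProbeSecondOrder refuted (R_2(n) = n³/2 + o(n²)) does not kill the
line but demotes the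
stability method; certified small cases (R_2 of ⟨4⟩,⟨6⟩ at n³/2 exactly) would do the same faster.

NOT DECOMPOSED YET. The stability engine (near-tight ⇒ near-idempotent ⇒ aggregation-shaped) is
deliberately not filed: its right formulation
depends on which of ranks 3/4 closes first. No item fixes θ; the prover of ScaleDeficit chooses it
(θ = 1/4: known slopes
≤ 0.79, so δ < 0.21 is the consistent window; θ = 1/2: only recursion is known, window δ < ω−2).
Rectangular and Y/Z
versions of the laws, the s-copy version of TwoProbeSecondOrder, exact small values (R_2(⟨4⟩) ∈
[32+?, 40+…]) and the
census of probe-rank profiles of the known ⟨3,3,3;23⟩ / ⟨4,4,4;48⟩ schemes are layer-2 material or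
kit jobs, later.

CHEAPEST FALSIFIER. (1) A kit/SAT search for a FLAT-TIGHT scheme at the smallest open size: ⟨4,4,4⟩
with 32 terms and all probe ranks ≤ 2 is
excluded (R ≥ 34, Bläser), so the first live instances are 2⊙⟨3,3,3⟩ in 27 terms with rank-sums ≤ 2
(XRankLaw floor 27;
Pan-2 gives 54; R(2⊙⟨3⟩) ≥ 19+9 = 28 already excludes it — so next: 2⊙⟨4⟩ in 64 terms with rank-sums
2, floor 64 vs
R(2⊙⟨4⟩) ≥ 34+16 = 50: OPEN and small enough for the probe-rank-restricted Brent equations, which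
have 4·(4m−4)-parameter
probes instead of m²). (2) Literature lookup the refuter should run first: is "Σ_l rank(U_l) ≥ kmn"
or "R_ρ ≥ kmn/ρ" already
printed (de Groote 1978, Brockett–Dobkin 1978, Bshouty, the sparse-decomposition/leading-coefficient
literature)? If yes the
support items are `known` (fine) and Novelty shrinks to the scale threshold. I verified the law and
Pan's identity in exact
arithmetic (n ≤ 3, m = 3) but could not run galaxy (queue > 90 s) or arXiv/OpenAlex (HTTP 429) this
session.

NUMBERS. Fixed ρ: n³/ρ ≤ R_ρ(n) ≤ (1+o(1))n³/ρ (ρ = 2^k; XRankLaw vs Pan-2 powers); ρ = 2: n³/2 ≤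
R_2(n) ≤ n³/2 + 3n² (n even).
Strassen once: 7n³/8 at ρ = 2; k levels: n³ρ^(−0.193), ρ = 2^k; best base (ω < 2.3714): n³ρ^(−0.63).
Card's F1: n³/ρ³ only.
Scale θ: baseline s(θ) ≤ θ (XRankLaw); Pan-2 powers s(θ) ≥ θ(1 − log₂(1+3·2^(−1/θ))) (θ = 1/4: 0.17;
θ = 1/3: 0.15);
Pan ⟨70;143640⟩ (probe rank ≤ 3, Kronsjo1986 Table 2.4.1): slope log(70³/143640)/log 3 = 0.792 for θ
≤ log 3/log 70 = 0.259
(θ = 1/4: s ≥ 0.198); SchwartzZwecher2026 ⟨44;36110⟩: σ = 2.36; recursion: slope 3−ω ≥ 0.6286 at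
every θ. Consistent
window for ScaleDeficit at θ = 1/4: 0 < δ < 0.21; at θ = 1/2: 0 < δ < ω−2. Items at open: 8 (3
cruxes, 4 support, 1 assembly).

DEFINITION REQUESTS. None. Probe rank is `(Matrix.of fun p q => u i (p, q)).rank` (Mathlib
`Matrix.rank`); decompositions are inlined over the
tree's `triad` / `matMulTensor` / `kroneckerTensor` / `unitTensor`; R_ρ(n) is never needed as an
sInf (all items quantify over
decompositions), so no junk values arise.

Novelty: Searches (2026-08-15): `lit search --hybrid "trilinear aggregating Pan two disjoint matrix products
n^3/2"` (8 docs: BCS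
pp. 453/627, Landsberg2017 p. 320, Kronsjo1986 pp. 16–20 = Pan's 1978 design verbatim, read); `lit
vsearch` "sum over
products of the ranks of the coefficient matrices … at least n cubed" (8 docs, none relevant: BCS
pp. 403/408, Landsberg2017
pp. 51/317); `lit search --source s2 "trilinear aggregating matrix multiplication Pan"` (10:
Pan1978/1979/1980/1982/1984,
HadasSchwartz2023, SchwartzZwecher2026 = arXiv:2508.01748 read pp. 1–5, Respondek 2023); `lit search
--source s2 "bilinear
algorithm linear forms of bounded rank restricted model lower bound"` (12: BrockettDobkin1973,
EGOW2018, noise);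
`lit galaxy search "ranks of the coefficient matrices bilinear algorithm" --star all` (queued out >
90 s, twice with the
audit's `galaxy read panama:450009493405707`); OpenAlex/arXiv HTTP 429 all session; the card's own
audit (refuter-9) read
Pan1984 §2–5, 10–13, BCS Ch. 14–17, Blaser2013 §5–6, Landsberg2017 for a probe-rank filtration
(absent).
Nearest prior art found: Pan1984 §4 / Pan1978 (aggregation designs = the extremisers; never analysed
by probe rank);
CoppersmithWinograd1982 (strictness of the x-variable flattening count for basic algorithms — the
model for StrictXRankLaw);
EfremenkoGargOliveiraWigderson2018 + Buczynski2026 (rank-method barriers, unrestricted model);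
Miller 1975 / Raz 2003
restricted bilinear models (stability, bounded coefficients); DeGroote  [refs: 2508.01748, Landsberg2017, Kronsjo1986, Pan1978, SchwartzZwecher2026, Pan1984, Blaser2013, CoppersmithWinograd1982, EfremenkoGargOliveiraWigderson2018, Buczynski2026, DeGroote1978]

Barriers (technique_class: restricted-model-lower-bounds, probe-rank-filtration): - technique_class: restricted-model-lower-bounds, probe-rank-filtration
- Literature.Barriers.MatrixMultiplication.LinearRankMethodBarrier: APPLIES to the frame — XRankLaw
is a linear rank method (a flattening of the 6-leg tensor) and FixedRankSaturation shows it is TIGHT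
at every fixed ρ, so no rank method uniform in ρ can give ScaleDeficit; the crux must use the
coupling ρ = n^θ (bounded blocks) non-linearly. Evasion = the stated bet: stability of the additive
case (rank-additive decompositions of a permutation matrix are complementary idempotents) and
CW82-type strictness, which are not determinantal equations; whether EGOW/cactus ceilings even hold
for the restricted secant (probe rank ≤ ρ) is uncatalogued and part of what rank 3 probes.
- Literature.Barriers.MatrixMultiplication.InfimumNotMinimumBarrier: consistent and used — the
transfer works with ω+δ/2 (exists_tensorRank_matMulTensor_le_rpow), never with an optimal base; CW82
strictness is imported as a resource for StrictXRankLaw, not contradicted.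
- Literature.Barriers.MatrixMultiplication.IrreversibilityBarrier: not in class (no intermediate
tensor, no degeneration value; a lower-bound line). Likewise UniversalMethod / UnstableTensor /
Rectangular / TricoloredSumFree / YoungSubgroup / NilpotentGroup / Normalizer / Quasirandom /
Equivoluminous: upper-bound-method barriers, not applicable.
- Negatives index: empty for MatrixMultiplication at filing (ledger negatives, 2026-08-15); the
card's own N1/N2 are recorded her

History (route lifecycle, newest last):
- 2026-08-22T08:31:31Z · DORMANT — reconciler: no traction for 5.2 d (last activity statement-grounded at 2026-08-17T02:57:16Z); parked, not closed — `ledger route dormant route-MatrixMultiplicat (operator:999:1328034)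

sub-problem: MatrixMultiplication · status: dormant · opened planner-plancard-MatrixMultiplication-MatrixM-a65c66f5-0 2026-08-15T11:48:43Z · rev 3 · ledger route-MatrixMultiplication-ProbeRankThreshold
GENERATED by the gate from the ledger (D-0016/17). Provers cite these decls: `theorem foo : Summit.MatrixMultiplication.MatrixMultiplication.Theses.ProbeRankThreshold.<Decl> := …` in Summits/MatrixMultiplication/MatrixMultiplication/Theorems/<Name>.lean.
-/

namespace Summit.MatrixMultiplication.MatrixMultiplication.Theses.ProbeRankThreshold

open scoped BigOperators Topology Manifold Classical MeasureTheory ProbabilityTheory Matrix InnerProductSpace ComplexConjugate ContinuousMap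
open Filter Set Function TopologicalSpace MeasureTheory

attribute [summit_statement] _root_.MatrixMultiplication

/-- item stmt-MatrixMultiplication-6600 · crux · rank 2 · open · by planner
why it might fail: False if ω=2 (recursion reaches n^(3−θ(1−ε)) at every θ). False even with ω>2 if some bounded design is flat-tight (¬StrictXRankLaw with m ≤ p²ᶿ… i.e. log p/log m ≥ θ) or a design family has slope → 1 at bounded block size; only tool today is the rank-method bound n^(3−θ) it must beat.
sources: Pan1984, Pan1978, CoppersmithWinograd1982, EfremenkoGargOliveiraWigderson2018, Blaser2013, SchwartzZwecher2026
[crux] X itself (card item N1 moved to the scale ρ = n^θ, the only regime consistent with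
aggregation): ∃ θ ∈ (0,1/2], δ > 0 such that for infinitely many n every decomposition of ⟨n,n,n⟩
into r rank-one terms whose 3r probes (legs read as n×n matrices) all have rank ≤ n^θ has r ≥
n^(3−θ(1−δ)). Baseline r ≥ n^(3−θ) is XRankLaw; the crux is the extra factor n^(θδ). [difficulty:
open-problem] -/
@[route_item "route-MatrixMultiplication-ProbeRankThreshold", crux]
def ScaleDeficit : Prop :=
  ∃ θ : ℝ, 0 < θ ∧ θ ≤ 1 / 2 ∧ ∃ δ : ℝ, 0 < δ ∧ ∀ n₀ : ℕ, ∃ n : ℕ, n₀ ≤ n ∧ ∀ (r : ℕ) (w u v : Fin r → Fin n × Fin n → ℂ), Literature.Computability.AlgebraicComplexity.matMulTensor ℂ n n n = ∑ i, Literature.Computability.AlgebraicComplexity.triad (w i) (u i) (v i) → (∀ i, ((Matrix.of fun p q => w i (p, q)).rank : ℝ) ≤ (n : ℝ) ^ θ ∧ ((Matrix.of fun p q => u i (p, q)).rank : ℝ) ≤ (n : ℝ) ^ θ ∧ ((Matrix.of fun p q => v i (p, q)).rank : ℝ) ≤ (n : ℝ) ^ θ) → (n : ℝ) ^ (3 -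 θ * (1 - δ)) ≤ (r : ℝ)

/-- item stmt-MatrixMultiplication-6601 · crux · rank 3 · open · by planner
why it might fail: For p=2, s=1 the window is [m³/2, m³/2+3m²] (XRankLaw vs Pan) and nothing known excludes r = m³/2 exactly for large m; weighted aggregation with internal cancellation, or de Groote-inequivalent tight schemes beyond ⟨2,2,2⟩ (where all optimal schemes are X-tight but not flat), could realise equality.
sources: CoppersmithWinograd1982, DeGroote1978, Pan1984, BurgisserClausenShokrollahi1997
[crux] NO FLAT-TIGHT DESIGN (first rigidity statement of the model; card item N2 corrected by the
audit and by XRankLaw): for all s, m ≥ 1, p ≥ 2 and every decomposition of the direct sum s⊙⟨m,m,m⟩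
(= kroneckerTensor (unitTensor s) ⟨m,m,m⟩) into r terms whose X-, Y- and Z-probes have rank-sum over
the s copies ≤ p, one has r·p > s·m³ strictly (XRankLaw gives ≥; equality would force every X-probe
rank-sum to equal p with the flattening exactly additive). A flat-tight design (equality) with log
p/log m ≥ θ would, by Kronecker powers and block embedding, give R_(n^θ')(n) = O(n^(3−θ')) for all
θ' ≤ log p/log m and kill ScaleDeficit there; so this crux is informative both ways and is the
refuters' natural target in finite form. [difficulty: L] -/
@[route_item "route-MatrixMultiplication-ProbeRankThreshold"]
def StrictXRankLaw : Prop :=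
  ∀ (s m p r : ℕ), 1 ≤ s → 1 ≤ m → 2 ≤ p → ∀ (w u v : Fin r → Fin s × (Fin m × Fin m) → ℂ), Literature.Computability.AlgebraicComplexity.kroneckerTensor (Literature.Computability.AlgebraicComplexity.unitTensor ℂ s) (Literature.Computability.AlgebraicComplexity.matMulTensor ℂ m m m) = ∑ i, Literature.Computability.AlgebraicComplexity.triad (w i) (u i) (v i) → (∀ i, ∑ c : Fin s, (Matrix.of fun p' q => w i (c, (p', q))).rank ≤ p ∧ ∑ c : Fin s, (Matrix.of fun p' q => u i (c, (p', q))).rank ≤ p ∧ ∑ c : Fin s, (Matrix.of fun p' q => v i (c, (p', q))).rank ≤ p) → s * m ^ 3 < r * p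

/-- item stmt-MatrixMultiplication-6602 · crux · rank 4 · open · by planner
why it might fail: The 3m² correction products of Pan-2 might be compressible to o(m²) by sharing them with the main aggregates or across the four block pairs (leading-coefficient reductions of this kind exist for arithmetic counts: Winograd, Karstadt–Schwartz, SchwartzZwecher2026); then R_2(n) = n³/2 + o(n²).
sources: Pan1984, Pan1980, SchwartzZwecher2026, Kronsjo1986
[crux] SECOND-ORDER OPTIMALITY OF AGGREGATION AT ENTANGLEMENT 2 (the audit's "right N2"): ∃ c > 0
such that for all large n every decomposition of ⟨n,n,n⟩ whose probes all have rank ≤ 2 has ≥ n³/2 +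
c·n² terms. Known: n³/2 ≤ R_2(n) ≤ n³/2 + 3n² + O(n) (XRankLaw; Pan-2 on ⟨2m⟩ = 4 block pairs,
padding for odd n). The quantitative shadow of StrictXRankLaw at p = 2 and the first test of the
stability method (near-additive flattenings ⇒ near-idempotent structure ⇒ correction terms cost ≥
c·n²). [difficulty: M] -/
@[route_item "route-MatrixMultiplication-ProbeRankThreshold"]
def TwoProbeSecondOrder : Prop :=
  ∃ c : ℝ, 0 < c ∧ ∀ᶠ n : ℕ in Filter.atTop, ∀ (r : ℕ) (w u v : Fin r → Fin n × Fin n → ℂ), Literature.Computability.AlgebraicComplexity.matMulTensor ℂ n n n = ∑ i, Literature.Computability.AlgebraicComplexity.triad (w i) (u i) (v i) → (∀ i, (Matrix.of fun p q => w i (p, q)).rank ≤ 2 ∧ (Matrix.of fun p q => u i (p, q)).rank ≤ 2 ∧ (Matrix.of fun p q => v i (p, q)).rank ≤ 2) → (n : ℝ) ^ 3 / 2 + c * (n : ℝ) ^ 2 ≤ (r : ℝ)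

/-- item stmt-MatrixMultiplication-18270 · crux · rank 5 · open · by planner
why it might fail: Multi-copy aggregation sharing correction terms across many copies, or group-algebra (STPP) packings of many ⟨m⟩ with m ≤ b (CohnKleinbergSzegedyUmans2005), could give families with r·p/(s·m³) → 1 as s, p → ∞ at fixed block size, leaving only the integrality gap.
sources: Pan1984, Pan1978, CohnKleinbergSzegedyUmans2005, Schonhage1981, Strassen1988, CoppersmithWinograd1982
[crux] AMORTIZED BLOCK STRICTNESS (piece X3; ω-blind — it concerns bounded blocks only): for every
block bound b there are γ > 0 and S₀ such that every design for s⊙⟨m,m,m⟩ with s ≥ S₀ copies, 1 ≤ m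
≤ b and rank-sums ≤ p (p ≥ 2) on all three legs has s·m³ ≤ r·p^(1−γ): the direct-sum X-rank law r·p
≥ s·m³ (one flattening) is missed by a factor p^γ UNIFORMLY in the number of copies and in the
budget — the quantitative 'no asymptotically flat bounded-block design family' (slope ≤ 1 − γ(b)).
Consistent with Pan's pair design (r = (s/2)(m³+3m²) at p = 2 forces γ(b) ≤ log₂(1+3/b)) and, at p ≥
m, with R(⟨m⟩) ≥ 2m²−1 for bounded m. Complements StrictXRankLaw (exact strictness, which the glue
uses for s < S₀). [difficulty: L] (why it might fail: Multi-copy aggregation sharing correction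
terms across many copies, or group-algebra (STPP) packings of many ⟨m⟩ with m ≤ b
(CohnKleinbergSzegedyUmans2005), could give families with r·p/(s·m³) → 1 as s, p → ∞ at fixed block
size, leaving only the integrality gap.) [Pan1984, Pan1978, CohnKleinbergSzegedyUmans2005,
Schonhage1981, Strassen1988, CoppersmithWinograd1982] Piece X3 of the BC2-redirect decomposition of
ScaleDeficit (stmt-MatrixMultiplicatio -/
@[route_item "route-MatrixMultiplication-ProbeRankThreshold"]
def AmortizedBlockStrictness : Prop :=
  ∀ b : ℕ, ∃ γ : ℝ, 0 < γ ∧ ∃ S₀ : ℕ, ∀ (s m p r : ℕ), S₀ ≤ s → 1 ≤ m → m ≤ b → 2 ≤ p → ∀ (w u v : Fin r → Fin s × (Fin m × Fin m) → ℂ), Literature.Computability.AlgebraicComplexity.kroneckerTensor (Literature.Computability.AlgebraicComplexity.unitTensor ℂ s) (Literature.Computability.AlgebraicComplexity.matMulTensor ℂ m m m) = ∑ i, Literature.Computability.AlgebraicComplexity.triad (w i) (u i) (v i) → (∀ i, ∑ c : Fin s, (Matrix.of fun p' q => w i (c, (p', q))).rank ≤ p ∧ ∑ c : Fin s, (Matrix.of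 fun p' q => u i (c, (p', q))).rank ≤ p ∧ ∑ c : Fin s, (Matrix.of fun p' q => v i (c, (p', q))).rank ≤ p) → ((s * m ^ 3 : ℕ) : ℝ) ≤ (r : ℝ) * (p : ℝ) ^ (1 - γ)

/-- item stmt-MatrixMultiplication-18287 · crux · rank 6 · open · by planner
why it might fail: If ω(ℂ)=2, recursion saturates every scale and X1 would force asymptotically flat bounded-block designs (= ¬AmortizedBlockStrictness); aggregation∘recursion mixtures with unbounded base, or STPP packings, might beat every bounded-block design by a factor n^Ω(1) at all scales ≤ 1/2.
sources: Pan1984, Pan1978, Schonhage1981, CoppersmithWinograd1982, Blaser2013, Strassen1988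
[crux] BOUNDED-BLOCK EXHAUSTION (piece X1 of the typed decomposition of ScaleDeficit; its status is
undetermined by the value of omega): at some scale θ ∈ (0,1/2] there is a block bound b such that
for every ε>0 and all large n, every decomposition of ⟨n,n,n⟩ with all probe ranks ≤ n^θ and r ≤ n^σ
terms is MATCHED BY A DESIGN — a decomposition of the direct sum s⊙⟨m,m,m⟩ = kroneckerTensor
(unitTensor s) ⟨m,m,m⟩ (any number s ≥ 1 of copies, block size 2 ≤ m ≤ b) into r₀ triads whose X-,
Y-, Z-probes have rank-SUM over the copies ≤ p (p ≥ 2; the vocabulary of StrictXRankLaw) — of scale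
≤ θ (p³ ≤ V^θ) and cost exponent ≤ σ+ε (r₀³ ≤ V^(σ+ε)), V = s·m³. Both exponents are invariant under
Kronecker powers, and the k-th power packed into ⟨⌊s^(k/3)⌋·m^k⟩ realises n ≈ V^(k/3), probe rank
p^k = n^(3 log p/log V), r₀^k terms (cf. FixedRankSaturation), so X1 says: bounded-block aggregation
(Pan-type designs, s and p unbounded) is asymptotically optimal at scale θ among ALL
probe-rank-restricted decompositions, including recursion on growing bases ⟨n^θ⟩. For the known
mechanisms this is true iff ω(ℂ) > 2 (Pan block-m pair design has slope 1 − log₂(1+3/m) → 1 as θ →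
0, recursion has slope 3 − ω_ -/
@[route_item "route-MatrixMultiplication-ProbeRankThreshold"]
def BoundedBlockExhaustion : Prop :=
  ∃ θ : ℝ, 0 < θ ∧ θ ≤ 1 / 2 ∧ ∃ b : ℕ, ∀ ε : ℝ, 0 < ε → ∃ n₁ : ℕ, ∀ n : ℕ, n₁ ≤ n → ∀ (r : ℕ) (w u v : Fin r → Fin n × Fin n → ℂ), Literature.Computability.AlgebraicComplexity.matMulTensor ℂ n n n = ∑ i, Literature.Computability.AlgebraicComplexity.triad (w i) (u i) (v i) → (∀ i, ((Matrix.of fun p q => w i (p, q)).rank : ℝ) ≤ (n : ℝ) ^ θ ∧ ((Matrix.of fun p q => u i (p, q)).rank : ℝ) ≤ (n : ℝ) ^ θ ∧ ((Matrix.of fun p q => v i (p, q)).rank : ℝ) ≤ (n : ℝ) ^ θ) → ∀ σ : ℝ, (r : ℝ) ≤ (n : ℝ) ^ σ → ∃ (s m p r₀ : ℕ), 1 ≤ s ∧ 2 ≤ m ∧ m ≤ b ∧ 2 ≤ p ∧ (p : ℝ) ^ 3 ≤ ((s * m ^ 3 : ℕ) : ℝ) ^ θ ∧ (r₀ : ℝ)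 ^ 3 ≤ ((s * m ^ 3 : ℕ) : ℝ) ^ (σ + ε) ∧ ∃ (w₀ u₀ v₀ : Fin r₀ → Fin s × (Fin m × Fin m) → ℂ), Literature.Computability.AlgebraicComplexity.kroneckerTensor (Literature.Computability.AlgebraicComplexity.unitTensor ℂ s) (Literature.Computability.AlgebraicComplexity.matMulTensor ℂ m m m) = ∑ i, Literature.Computability.AlgebraicComplexity.triad (w₀ i) (u₀ i) (v₀ i) ∧ ∀ i, ∑ c : Fin s, (Matrix.of fun p' q => w₀ i (c, (p', q))).rank ≤ p ∧ ∑ c : Fin s, (Matrix.of fun p' q => u₀ i (c, (p', q))).rank ≤ p ∧ ∑ c : Fin s, (Matrix.of fun p' q => v₀ i (c, (p', q))).rank ≤ p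

/-- item stmt-MatrixMultiplication-6603 · support · rank 9 · closed · proved by Summit.MatrixMultiplication.MatrixMultiplication.Theorems.xRankLaw_proof @ 98fbf36d5a5c (prover) · by planner
sources: Blaser2013, Landsberg2017, ChristandlVranaZuiddam2023
[support] X-RANK LAW (provable now; supersedes the card's F1): for every decomposition ⟨k,m,n⟩ =
Σ_(i<r) w_i⊗u_i⊗v_i over ℂ, Σ_i rank(u_i read as a k×m matrix) ≥ k·m·n. Proof: flatten the 6-leg
tensor with rows (b.1, c.1, c.2) and columns (b.2, a.1, a.2) (slots a = Z-position (κ,ν), b = X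
(κ,μ), c = Y (μ,ν) of matMulTensor): ⟨k,m,n⟩ becomes a permutation matrix of rank kmn, the i-th term
becomes U_i ⊗ (v_i w_iᵀ-block) of rank rank(U_i); rank is subadditive (Matrix.rank_add_le). By the
cyclic symmetry the same holds for Σ rank(v_i) and Σ rank(w_i). Corollary: probe rank ≤ ρ on the
X-legs alone forces r ≥ kmn/ρ. Verified numerically (exact arithmetic) for k=m=n ≤ 3 in the planner
folder. [difficulty: provable-now] -/
@[route_item "route-MatrixMultiplication-ProbeRankThreshold"]
def XRankLaw : Prop :=
  ∀ (k m n r : ℕ) (w : Fin r → Fin k × Fin n → ℂ) (u : Fin r → Fin k × Fin m → ℂ) (v : Fin r → Fin m × Fin n → ℂ), Literature.Computability.AlgebraicComplexity.matMulTensor ℂ k m n = ∑ i, Literature.Computability.AlgebraicComplexity.triad (w i) (u i) (v i) → k * m * n ≤ ∑ i, (Matrix.of fun p q => u i (p, q)).rank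

/-- item stmt-MatrixMultiplication-6604 · support · rank 9 · closed · proved by Summit.MatrixMultiplication.MatrixMultiplication.Theorems.recursionTransfer_proof @ e58aea45872a (prover) · by planner
sources: Blaser2013, BurgisserClausenShokrollahi1997
[support] THRESHOLD ENGINE (card F2, provable now): from any decomposition of ⟨a,a,a⟩ into r terms
and any m, n with n ≤ a·m, build a decomposition of ⟨n,n,n⟩ into r·m³ terms all of whose probes have
rank ≤ a: Kronecker product with the schoolbook decomposition of ⟨m,m,m⟩
(kroneckerTensor_matMulTensor / doubleIndexEquiv; the probe u_i ⊗ e_pq is U_i ⊗ E_pq, supported on a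
rows, rank ≤ a), then restrict all six indices along Fin n ↪ Fin (a·m) (matMulTensor entries depend
only on index equalities; probes become submatrices, rank non-increasing, Matrix.rank_submatrix_le).
Used by Assembly with a = ⌊n^θ⌋, m = ⌈n/a⌉ and r = R(⟨a,a,a⟩) ≤ C·a^(2+δ/2) from
exists_tensorRank_matMulTensor_le_rpow (+ exists_triad_decomposition_tensorRank). [difficulty:
provable-now] -/
@[route_item "route-MatrixMultiplication-ProbeRankThreshold", crux]
def RecursionTransfer : Prop :=
  ∀ (a m n r : ℕ), n ≤ a * m → ∀ (w u v : Fin r → Fin a × Fin a → ℂ), Literature.Computability.AlgebraicComplexity.matMulTensor ℂ a a a = ∑ i, Literature.Computability.AlgebraicComplexity.triad (w i) (u i) (v i) → ∃ (w' u' v' : Fin (r * m ^ 3) → Fin n × Fin n → ℂ), Literature.Computability.AlgebraicComplexity.matMulTensor ℂ n n n = ∑ i, Literature.Computability.AlgebraicComplexity.triad (w' i) (u' i) (v' i) ∧ ∀ i, (Matrix.of fun p q => w' i (p, q)).rank ≤ a ∧ (Matrix.of fun p q => u' i (p, q)).rank ≤ a ∧ (Matrix.of fun p q => v' i (p, q)).rank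 ≤ a

/-- item stmt-MatrixMultiplication-6605 · support · rank 9 · closed · proved by Summit.MatrixMultiplication.MatrixMultiplication.Theorems.panAggregation_proof @ 7c01509ecb42 (prover) · by planner
sources: Pan1984, Pan1978, Kronsjo1986
[support] PAN'S TWO-FOLD AGGREGATION, TENSORED ONCE (calibration; provable now, laborious): for
every m, ⟨2m,2m,2m⟩ has a decomposition into 4m³ + 12m² terms all of whose probes have rank ≤ 2.
Construction: ⟨2,2,2⟩ ≤ ⟨8⟩ splits ⟨2m⟩ into 8 block products = 4 disjoint pairs; each pair 2⊙⟨m⟩ =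
Σ_ijk (a_ij+u_jk)(b_jk+v_ki)(c_ki+w_ij) − Σ_ij a_ij(Σ_k b_jk + Σ_k v_ki)w_ij − Σ_ki (Σ_j a_ij + Σ_j
u_jk)v_ki c_ki − Σ_jk u_jk b_jk(Σ_i c_ki + Σ_i w_ij) (m³ + 3m² products; identity checked in exact
arithmetic for m = 3); every probe is a 2-entry matrix or entry+row/column-sum, rank ≤ 2 after block
placement (Pan1984 §4 eqs (4.1)–(4.3) = Pan 1972; Kronsjo1986 pp. 18–20 prints the 3-fold sibling
⟨70;143640⟩ with probes of rank ≤ 3). [difficulty: M] -/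
@[route_item "route-MatrixMultiplication-ProbeRankThreshold"]
def PanAggregation : Prop :=
  ∀ m : ℕ, ∃ (w u v : Fin (4 * m ^ 3 + 12 * m ^ 2) → Fin (2 * m) × Fin (2 * m) → ℂ), Literature.Computability.AlgebraicComplexity.matMulTensor ℂ (2 * m) (2 * m) (2 * m) = ∑ i, Literature.Computability.AlgebraicComplexity.triad (w i) (u i) (v i) ∧ ∀ i, (Matrix.of fun p q => w i (p, q)).rank ≤ 2 ∧ (Matrix.of fun p q => u i (p, q)).rank ≤ 2 ∧ (Matrix.of fun p q => v i (p, q)).rank ≤ 2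

/-- item stmt-MatrixMultiplication-6606 · support · rank 9 · closed · proved by Summit.MatrixMultiplication.MatrixMultiplication.Theorems.fixedRankSaturation_proof (prover) · by planner
sources: Pan1984, Pan1978, Blaser2013
[support] FIXED-ENTANGLEMENT SATURATION (the formal refutation of the card's original N1/N2 and the
reason the route lives at scale n^θ): for every k and ε > 0, for all large n, ⟨n,n,n⟩ has a
decomposition with ≤ (1+ε)n³/2^k terms and all probe ranks ≤ 2^k. Proof: k-th Kronecker power of the
pair design (2⊙⟨m⟩ in m³+3m², probe rank-sums ≤ 2 ⇒ 2^k⊙⟨m^k⟩ in (m³+3m²)^k with rank-sums ≤ 2^k),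
block embedding ⟨2^j,2^j,2^j⟩ ≤ ⟨8^j⟩ with 8^j = 2^k·2^(3j−k) (j = ⌈k/3⌉) into ⟨2^j m^k⟩, m → ∞, and
zero-padding monotonicity n ≤ 2^j m^k ≤ (1+1/m)^k n. With XRankLaw: R_ρ(n) = (1+o(1))·n³/ρ along ρ =
2^k — the fixed-ρ filtration is exactly solved and ω-blind. [difficulty: L] -/
@[route_item "route-MatrixMultiplication-ProbeRankThreshold"]
def FixedRankSaturation : Prop :=
  ∀ (k : ℕ) (ε : ℝ), 0 < ε → ∀ᶠ n : ℕ in Filter.atTop, ∃ (r : ℕ) (w u v : Fin r → Fin n × Fin n → ℂ), (r : ℝ) ≤ (1 + ε) * (n : ℝ) ^ 3 / 2 ^ k ∧ Literature.Computability.AlgebraicComplexity.matMulTensor ℂ n n n = ∑ i, Literature.Computability.AlgebraicComplexity.triad (w i) (u i) (v i) ∧ ∀ i, (Matrix.of fun p q => w i (p, q)).rank ≤ 2 ^ k ∧ (Matrix.of fun p q => u i (p, q)).rank ≤ 2 ^ k ∧ (Matrix.of fun p q => v i (p, q)).rank ≤ 2 ^ k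

/-- item stmt-MatrixMultiplication-7966 · support · rank 9 · closed · proved by Summit.MatrixMultiplication.MatrixMultiplication.Theorems.fourthMomentPacking_proof @ f7e5fa294c18 (prover) · by planner
[support] FOURTH-MOMENT PACKING (by-product for the host programme, grafted from the merged
duplicate route ProbeRankScaling / card one-leg-probe-rank-law (C2); refines CohnUmans2003 Lemma 3.1
and Neumann2011 Obs 4.1): if a finite group G realizes ⟨n,m,p⟩ through a TPP triple (hypothesis =
Literature.Computability.AlgebraicComplexity.RealizesTPP G n m p, inlined verbatim) and ℂ[G] ≃ₐ Π_i
M_{d_i}(ℂ) (= Literature.RepresentationTheory.FiniteGroups.BlockAlgebraC d, inlined), then n·m·p ≤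
Σ_i d_i⁴. Proof: the Cohn–Umans embedding writes ⟨n,m,p⟩ as Σ_i Σ_{a,b,c<d_i} of triads whose
X-probes are the n×m matrices (x,y) ↦ φ(s_x t_y⁻¹)_i[a,b] = Σ_c φ(s_x)_i[a,c]·φ(t_y⁻¹)_i[c,b], of
rank ≤ d_i; XRankLaw (Σ rank ≥ nmp) then gives nmp ≤ Σ_i d_i³·d_i. Consequences (not filed):
abelian/torus hosts certify nothing (Σd⁴ = cost); with CU03 Thm 4.1 (tree:
rpow_omega_le_sum_blockDegrees_rpow) irreps that can carry ω → 2 need d_max ≥ |G|^{1/4−o(1)}.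
Checks: S_3 max TPP nmp 8 ≤ 18, A_4 18 ≤ 84, S_4 36 ≤ 180, D_10 12 ≤ 34 (HedtkeMurthy2012).
[sources: CohnUmans2003, BlasiakCohnGrochowPrattUmans2024, Neumann2011, HedtkeMurthy2012]
[difficulty: M] -/
@[route_item "route-MatrixMultiplication-ProbeRankThreshold"]
def FourthMomentPacking : Prop :=
  ∀ (G : Type) [Group G] [Finite G] (n m p : ℕ), (∃ S T U : Finset G, S.card = n ∧ T.card = m ∧ U.card = p ∧ ∀ s ∈ S, ∀ s' ∈ S, ∀ t ∈ T, ∀ t' ∈ T, ∀ u ∈ U, ∀ u' ∈ U, s * s'⁻¹ * (t * t'⁻¹) * (u * u'⁻¹) = 1 → s = s' ∧ t = t' ∧ u = u') → ∀ (r : ℕ) (d : Fin r → ℕ), Nonempty (MonoidAlgebra ℂ G ≃ₐ[ℂ] (Π i : Fin r, Matrix (Fin (d i)) (Fin (d i)) ℂ)) → n * m * p ≤ ∑ i, d i ^ 4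

/-- item stmt-MatrixMultiplication-6607 · assembly · rank 1 · open · by planner
sources: Blaser2013, BurgisserClausenShokrollahi1997
[assembly] ScaleDeficit → ¬MatrixMultiplication (via RecursionTransfer,
exists_tensorRank_matMulTensor_le_rpow, exists_triad_decomposition_tensorRank and floor/ceiling
arithmetic). -/
@[route_item "route-MatrixMultiplication-ProbeRankThreshold"]
def Assembly : Prop :=
  ScaleDeficit → ¬ MatrixMultiplication

/-! D-0027 §2.1 — DECIDING THEOREM (planner-authored via `route open/edit --closes-file`; by planner-rbadge-MatrixMultiplication-ProbeRankT-cda7910d-g2-0 2026-08-15T16:22:33Z):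
its hypotheses are this route's items and its conclusion the sub-problem Statement (glue_lint), and it elaborates with this file. -/

/-- DECIDING THEOREM (D-0027 §2.1, refutation line): `ScaleDeficit` (the thesis X, at scale
`θ ∈ (0,1/2]` with gain `δ > 0`) together with the support item `RecursionTransfer` (Kronecker
recursion on a base `⟨a,a,a⟩` with classical inner blocks keeps every probe rank `≤ a`) refutes
`ω(ℂ) = 2`: if `ω(ℂ) = 2` then `2 + δ/2` is an admissible exponent, so `R(⟨a,a,a⟩) ≤ C·a^{2+δ/2}`
for all `a ≥ 1` (`Asymptotics.bound_of_isBigO_nat_atTop`); for each of the infinitely many `n` of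
`ScaleDeficit` put `a := ⌊n^θ⌋₊ ≥ 1`, `m := n/a + 1` (`n ≤ a·m`, `m ≤ 3·n^{1−θ}` because
`a > n^θ/2` and `n^{1−θ} ≥ 1`), take an optimal decomposition of `⟨a,a,a⟩` (the infimum defining
`tensorRank` is attained: the coordinate decomposition shows the defining set non-empty) and transfer
it: `⟨n,n,n⟩` gets `R(⟨a,a,a⟩)·m³ ≤ 27·C·n^{3−θ+θδ/2}` triads with all probe ranks `≤ a ≤ n^θ`, whence
`n^{3−θ+θδ} ≤ 27·C·n^{3−θ+θδ/2}`, i.e. `n^{θδ/2} ≤ 27·C` — false for `n` large. -/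
@[closes "route-MatrixMultiplication-ProbeRankThreshold"] theorem closes (hX : ScaleDeficit) (hT : RecursionTransfer) : ¬ _root_.MatrixMultiplication := by
  intro hM
  rw [MatrixMultiplication_iff] at hM
  obtain ⟨θ, hθ, hθhalf, δ, hδ, hinf⟩ := hX
  -- (A) `ω(ℂ) = 2` ⇒ `R(⟨a,a,a⟩) ≤ C·a^{2+δ/2}` whenever `a ≥ 1`
  have hlt : sInf (Literature.Computability.AlgebraicComplexity.admissibleExponents ℂ) < 2 + δ / 2 := by
    show Literature.Computability.AlgebraicComplexity.omega ℂ < 2 + δ / 2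
    rw [hM]
    linarith
  obtain ⟨β, hβ, hβlt⟩ := exists_lt_of_csInf_lt
    (Literature.Computability.AlgebraicComplexity.admissibleExponents_nonempty ℂ) hlt
  have hmem : (2 + δ / 2 : ℝ) ∈ Literature.Computability.AlgebraicComplexity.admissibleExponents ℂ :=
    Literature.Computability.AlgebraicComplexity.mem_admissibleExponents_of_le ℂ hβ hβlt.le
  obtain ⟨C, hC, hb⟩ := Asymptotics.bound_of_isBigO_nat_atTop hmem
  have hrank : ∀ a : ℕ, 1 ≤ a →
      (Literature.Computability.AlgebraicComplexity.tensorRank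
        (Literature.Computability.AlgebraicComplexity.matMulTensor ℂ a a a) : ℝ)
        ≤ C * (a : ℝ) ^ (2 + δ / 2) := by
    intro a ha
    have ha0 : (0 : ℝ) < a := by exact_mod_cast ha
    have hg : (a : ℝ) ^ (2 + δ / 2) ≠ 0 := (Real.rpow_pos_of_pos ha0 _).ne'
    have := hb hg
    rwa [Real.norm_of_nonneg (Nat.cast_nonneg _),
      Real.norm_of_nonneg (Real.rpow_nonneg ha0.le _)] at this
  -- (B) the infimum defining `tensorRank ⟨a,a,a⟩` is attained (finite index types)
  have hdec : ∀ a : ℕ,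
      ∃ (w u v : Fin (Literature.Computability.AlgebraicComplexity.tensorRank
          (Literature.Computability.AlgebraicComplexity.matMulTensor ℂ a a a)) → Fin a × Fin a → ℂ),
        Literature.Computability.AlgebraicComplexity.matMulTensor ℂ a a a
          = ∑ i, Literature.Computability.AlgebraicComplexity.triad (w i) (u i) (v i) := by
    intro a
    set t := Literature.Computability.AlgebraicComplexity.matMulTensor ℂ a a a with ht
    have key : t = ∑ p : (Fin a × Fin a) × (Fin a × Fin a) × (Fin a × Fin a),
        Literature.Computability.AlgebraicComplexity.triad (Pi.single p.1 (t p.1 p.2.1 p.2.2))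
          (Pi.single p.2.1 (1 : ℂ)) (Pi.single p.2.2 (1 : ℂ)) := by
      funext x y z
      rw [Finset.sum_apply, Finset.sum_apply, Finset.sum_apply]
      simp only [Literature.Computability.AlgebraicComplexity.triad_apply]
      rw [Fintype.sum_eq_single (x, y, z)]
      · simp
      · rintro ⟨x', y', z'⟩ hne
        by_cases hx : x' = x
        · subst hx
          by_cases hy : y' = y
          · subst hy
            have hz : z' ≠ z := fun h => hne (by rw [h])
            simp [hz.symm]
          · simp [Pi.single_apply, Ne.symm hy]
        · simp [Pi.single_apply, Ne.symm hx]
    set e := Fintype.equivFin ((Fin a × Fin a) × (Fin a × Fin a) × (Fin a × Fin a)) with he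
    have hmemS : Fintype.card ((Fin a × Fin a) × (Fin a × Fin a) × (Fin a × Fin a)) ∈
        {r : ℕ | ∃ (w : Fin r → Fin a × Fin a → ℂ) (u : Fin r → Fin a × Fin a → ℂ)
          (v : Fin r → Fin a × Fin a → ℂ),
          t = ∑ i, Literature.Computability.AlgebraicComplexity.triad (w i) (u i) (v i)} := by
      refine ⟨fun i => Pi.single (e.symm i).1 (t (e.symm i).1 (e.symm i).2.1 (e.symm i).2.2),
        fun i => Pi.single (e.symm i).2.1 1, fun i => Pi.single (e.symm i).2.2 1, ?_⟩
      exact key.trans (Fintype.sum_equiv e.symm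
        (fun i => Literature.Computability.AlgebraicComplexity.triad
          (Pi.single (e.symm i).1 (t (e.symm i).1 (e.symm i).2.1 (e.symm i).2.2))
          (Pi.single (e.symm i).2.1 (1 : ℂ)) (Pi.single (e.symm i).2.2 (1 : ℂ)))
        (fun p : (Fin a × Fin a) × (Fin a × Fin a) × (Fin a × Fin a) =>
          Literature.Computability.AlgebraicComplexity.triad (Pi.single p.1 (t p.1 p.2.1 p.2.2))
            (Pi.single p.2.1 (1 : ℂ)) (Pi.single p.2.2 (1 : ℂ))) (fun _ => rfl)).symm
    exact Nat.sInf_mem (s := {r : ℕ | ∃ (w : Fin r → Fin a × Fin a → ℂ)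
      (u : Fin r → Fin a × Fin a → ℂ) (v : Fin r → Fin a × Fin a → ℂ),
      t = ∑ i, Literature.Computability.AlgebraicComplexity.triad (w i) (u i) (v i)}) ⟨_, hmemS⟩
  -- (C) pick one of the infinitely many `n` of `ScaleDeficit`, beyond the threshold `n^{θδ/2} > 27·C`
  have hev : ∀ᶠ n : ℕ in atTop, 27 * C < (n : ℝ) ^ (θ * δ / 2) :=
    ((tendsto_rpow_atTop (by positivity)).comp tendsto_natCast_atTop_atTop).eventually_gt_atTop _
  obtain ⟨n₀, hn₀⟩ := eventually_atTop.1 (hev.and (eventually_ge_atTop 1))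
  obtain ⟨n, hn₀n, hn⟩ := hinf n₀
  obtain ⟨hbig, hn1⟩ := hn₀ n hn₀n
  have hn1' : (1 : ℝ) ≤ n := by exact_mod_cast hn1
  have hnpos : (0 : ℝ) < n := by linarith
  -- the base size `a = ⌊n^θ⌋₊` and the number of blocks `m = n/a + 1`
  have hA1 : (1 : ℝ) ≤ (n : ℝ) ^ θ := Real.one_le_rpow hn1' hθ.le
  obtain ⟨a, ha⟩ : ∃ a : ℕ, a = ⌊(n : ℝ) ^ θ⌋₊ := ⟨_, rfl⟩
  have ha1 : 1 ≤ a := by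
    rw [ha]
    exact Nat.le_floor (by exact_mod_cast hA1)
  have hapos : 0 < a := ha1
  have haposR : (0 : ℝ) < a := by exact_mod_cast hapos
  have haA : (a : ℝ) ≤ (n : ℝ) ^ θ := by
    rw [ha]
    exact Nat.floor_le (by positivity)
  have hAa : (n : ℝ) ^ θ < a + 1 := by
    rw [ha]
    exact Nat.lt_floor_add_one _
  have ha1R : (1 : ℝ) ≤ a := by exact_mod_cast ha1
  have hA2a : (n : ℝ) ^ θ ≤ 2 * a := by linarith
  obtain ⟨m, hm⟩ : ∃ m : ℕ, m = n / a + 1 := ⟨_, rfl⟩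
  have hnam : n ≤ a * m := by
    rw [hm]
    exact (Nat.lt_mul_div_succ n hapos).le
  -- `m ≤ 3·n^{1−θ}`
  have hsplit1 : (n : ℝ) ^ θ * (n : ℝ) ^ (1 - θ) = n := by
    rw [← Real.rpow_add hnpos]
    norm_num
  have hB1 : (1 : ℝ) ≤ (n : ℝ) ^ (1 - θ) := Real.one_le_rpow hn1' (by linarith)
  have hBpos : (0 : ℝ) < (n : ℝ) ^ (1 - θ) := by linarith
  have hmR : (m : ℝ) ≤ 3 * (n : ℝ) ^ (1 - θ) := by
    have h1 : (m : ℝ) = ((n / a : ℕ) : ℝ) + 1 := by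
      rw [hm]
      push_cast
      ring
    have h2 : ((n / a : ℕ) : ℝ) ≤ (n : ℝ) / a := Nat.cast_div_le
    have h3 : (n : ℝ) / a ≤ 2 * (n : ℝ) ^ (1 - θ) := by
      rw [div_le_iff₀ haposR]
      have : (n : ℝ) = (n : ℝ) ^ θ * (n : ℝ) ^ (1 - θ) := hsplit1.symm
      nlinarith [hA2a, hBpos.le, this]
    linarith
  have hm0 : (0 : ℝ) ≤ m := Nat.cast_nonneg _
  have hm3 : (m : ℝ) ^ 3 ≤ 27 * (n : ℝ) ^ (3 * (1 - θ)) := by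
    have h1 : (m : ℝ) ^ 3 ≤ (3 * (n : ℝ) ^ (1 - θ)) ^ 3 := by
      exact pow_le_pow_left₀ hm0 hmR 3
    have h2 : ((n : ℝ) ^ (1 - θ)) ^ 3 = (n : ℝ) ^ (3 * (1 - θ)) := by
      rw [← Real.rpow_natCast, ← Real.rpow_mul hnpos.le]
      congr 1
      push_cast
      ring
    calc (m : ℝ) ^ 3 ≤ (3 * (n : ℝ) ^ (1 - θ)) ^ 3 := h1
      _ = 27 * ((n : ℝ) ^ (1 - θ)) ^ 3 := by ring
      _ = 27 * (n : ℝ) ^ (3 * (1 - θ)) := by rw [h2]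
  -- the rank of the base: `R(⟨a,a,a⟩) ≤ C·a^{2+δ/2} ≤ C·n^{θ(2+δ/2)}`
  set R := Literature.Computability.AlgebraicComplexity.tensorRank
    (Literature.Computability.AlgebraicComplexity.matMulTensor ℂ a a a) with hR
  have hRle : (R : ℝ) ≤ C * (n : ℝ) ^ (θ * (2 + δ / 2)) := by
    have h1 : (R : ℝ) ≤ C * (a : ℝ) ^ (2 + δ / 2) := hrank a ha1
    have h2 : (a : ℝ) ^ (2 + δ / 2) ≤ ((n : ℝ) ^ θ) ^ (2 + δ / 2) :=
      Real.rpow_le_rpow haposR.le haA (by linarith)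
    have h3 : ((n : ℝ) ^ θ) ^ (2 + δ / 2) = (n : ℝ) ^ (θ * (2 + δ / 2)) := by
      rw [← Real.rpow_mul hnpos.le]
    calc (R : ℝ) ≤ C * (a : ℝ) ^ (2 + δ / 2) := h1
      _ ≤ C * ((n : ℝ) ^ θ) ^ (2 + δ / 2) := by exact mul_le_mul_of_nonneg_left h2 hC.le
      _ = C * (n : ℝ) ^ (θ * (2 + δ / 2)) := by rw [h3]
  -- (D) transfer the optimal base decomposition to `⟨n,n,n⟩` and apply `ScaleDeficit`
  obtain ⟨w, u, v, hwuv⟩ := hdec a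
  obtain ⟨w', u', v', hdec', hranks⟩ := hT a m n R hnam w u v hwuv
  have hprobe : ∀ i, ((Matrix.of fun p q => w' i (p, q)).rank : ℝ) ≤ (n : ℝ) ^ θ ∧
      ((Matrix.of fun p q => u' i (p, q)).rank : ℝ) ≤ (n : ℝ) ^ θ ∧
      ((Matrix.of fun p q => v' i (p, q)).rank : ℝ) ≤ (n : ℝ) ^ θ := by
    intro i
    obtain ⟨h1, h2, h3⟩ := hranks i
    exact ⟨(Nat.cast_le.mpr h1).trans haA, (Nat.cast_le.mpr h2).trans haA,
      (Nat.cast_le.mpr h3).trans haA⟩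
  have hdef := hn (R * m ^ 3) w' u' v' hdec' hprobe
  -- (E) exponent bookkeeping: `n^{3−θ+θδ} ≤ 27·C·n^{3−θ+θδ/2}`
  have hcast : ((R * m ^ 3 : ℕ) : ℝ) = (R : ℝ) * (m : ℝ) ^ 3 := by push_cast; ring
  rw [hcast] at hdef
  have hQpos : (0 : ℝ) < (n : ℝ) ^ (3 - θ + θ * δ / 2) := Real.rpow_pos_of_pos hnpos _
  have hsplit : (n : ℝ) ^ (3 - θ * (1 - δ))
      = (n : ℝ) ^ (θ * δ / 2) * (n : ℝ) ^ (3 - θ + θ * δ / 2) := by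
    rw [← Real.rpow_add hnpos]
    congr 1
    ring
  have hjoin : (n : ℝ) ^ (θ * (2 + δ / 2)) * (n : ℝ) ^ (3 * (1 - θ))
      = (n : ℝ) ^ (3 - θ + θ * δ / 2) := by
    rw [← Real.rpow_add hnpos]
    congr 1
    ring
  have hR0 : (0 : ℝ) ≤ R := Nat.cast_nonneg _
  have hup : (R : ℝ) * (m : ℝ) ^ 3 ≤ 27 * C * (n : ℝ) ^ (3 - θ + θ * δ / 2) := by
    calc (R : ℝ) * (m : ℝ) ^ 3
        ≤ (C * (n : ℝ) ^ (θ * (2 + δ / 2))) * (27 * (n : ℝ) ^ (3 * (1 - θ))) :=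
          mul_le_mul hRle hm3 (by positivity) (by positivity)
      _ = 27 * C * ((n : ℝ) ^ (θ * (2 + δ / 2)) * (n : ℝ) ^ (3 * (1 - θ))) := by ring
      _ = 27 * C * (n : ℝ) ^ (3 - θ + θ * δ / 2) := by rw [hjoin]
  rw [hsplit] at hdef
  have hfin : (n : ℝ) ^ (θ * δ / 2) ≤ 27 * C :=
    le_of_mul_le_mul_right (hdef.trans hup) hQpos
  linarith

end Summit.MatrixMultiplication.MatrixMultiplication.Theses.ProbeRankThreshold
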